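import Summits.QuantumFields.YangMills.Theorems.LuscherReductionTwistedTraceScalingBTDiagonalIntegral
import HarnessLib

/-!
# (L2) NEAR PAIRS, exact part: the integrand of `fpBOKernel(u,u')/K₁(u,u')` is the DIAGONAL integrand times `exp(offX)`, the kinetic slow-difference is affine in `w_k = u_ku'_k⁻¹`,
# and a pointwise bound `|offX| ≤ η` integrates to `e^{−η}f(u,u) ≤ f(u,u') ≤ e^{η}f(u,u)` (lane A of S-BASE, crux `TwistedTraceScaling` stmt-QuantumFields-20203, C4-CORE, the (B-T) pen;
# design note `pub/ym-fleet/ym-luscher-20007-p1/COARSE-DESIGN.md` §25.6 (L2), §25.7)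

* `offX β u u' v v' g` — the off-diagonal Laplace exponent relative to the diagonal `(u,u)`; ★★ `transferKernel_orthoTube_offdiag_div` — EXACT factorisation
  `K(oT u v, g·oT u' v')/K₁(u,u') = [K(oT u v, g·oT u v')/K₁(u,u)]·exp(offX)`;
* ★ `re_trace_mul_mul_mul_sub` — `Re tr(A·h·w·B) − Re tr(A·h·B) = 2[(w⁰−1)(BAh)⁰ − w⃗·(BAh)⃗]` (the kinetic slow-difference of a link is AFFINE in the relative slow rotation `w`);
  `timeCoupling_orthoTube_gauge_offdiag_sub` — on the tube: `TC(oT u v, g·oT u' v') − TC(oT u v, g·oT u v') = Σ_e 2[(w⁰_k−1)Q⁰_e − a⃗_k·Q⃗_e]`, `Q_e = chart(v'_e)⁻¹g_x⁻¹chart(v_e)·Ad_{u_k}(g_y)`,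
  `w_k = u_ku'_k⁻¹ = (w⁰_k, a⃗_k)`;
* ★★★ `fpBOKernel_offdiag_two_sided` — for `Ω, W ≥ 0`: if `|offX| ≤ η` on `supp Ω × supp Ω × supp W`, then `e^{−η}·f(u,u) ≤ f(u,u') ≤ e^{η}·f(u,u)`, `f(u,u') = fpBOKernel(u,u')/K₁^{(L³β)}(u,u')`
  (pure monotonicity: NO cancellation is needed for near pairs, §25.6 (L2)).
The successor bounds `offX` pointwise on the core by `O(β·|a⃗|·|z|²) + O(β|a⃗|δ|Σ_x g⃗_x|)` (`abs_vecPart_prod4_sub_sum_le` for `Q⃗_e`, balance + `gaugeLinear_sum_eq`-telescoping for the linear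
part, `norm_covCurl_step_sub_le` for the magnetic part), `= O(B^{-1/2}log³β)` for `|a⃗| ≤ B^{-1/2}log β` ((L1) sends the other pairs to the absolute tail).
HONEST FRAMING: exact algebra + monotone integration for a stub of a child of the CONDITIONAL reduction route R2b1; (B-T) bookkeeping OPEN; C4-CORE OPEN; not infinite volume, not a gap, not Clay.
-/

set_option autoImplicit false

noncomputable section

open MeasureTheory Filter Topology Real
open scoped BigOperators Matrix
open Literature.MathematicalPhysics.QuantumFieldTheory
open Literature.MathematicalPhysics.QuantumLattice

namespace Summit.QuantumFields.YangMills.Theorems.FemtoTransferGap.TwoLattice.ConstTube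

open Summit.QuantumFields.YangMills.Theorems.FemtoTransferGap
open Summit.QuantumFields.YangMills.Theorems.FemtoTransferGap.TwoLattice
open Summit.QuantumFields.YangMills.Theorems.FemtoTransferGap.TwoLattice.Avg
open Summit.QuantumFields.YangMills.Theorems.FemtoTransferGap.TwoLattice.Toron (wilsonAction_constLift_eq)
open Summit.QuantumFields.YangMills.Theorems.FemtoTransferGap.TwoLattice.Stiff (LinkSpace)

variable (L : ℕ) [NeZero L]

/-! ## §1 The off-diagonal exponent and the exact factorisation -/

/-- **The off-diagonal Laplace exponent** relative to the diagonal `(u,u)`. [cite: Luscher1983, §3] -/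
def offX (β : ℝ) (u u' : GaugeConfig 3 1 SU2) (v v' : Edge 3 L → Fin 3 → ℝ) (g : Site 3 L → SU2) : ℝ :=
  β * ((timeCoupling su2Rep (orthoTube L u v) (gaugeTransform g (orthoTube L u' v')) - (L : ℝ) ^ 3 * timeCoupling su2Rep u u') -
        (timeCoupling su2Rep (orthoTube L u v) (gaugeTransform g (orthoTube L u v')) - (L : ℝ) ^ 3 * timeCoupling su2Rep u u)) -
    β / 2 * ((wilsonAction su2Rep (orthoTube L u' v') - (L : ℝ) ^ 3 * wilsonAction su2Rep u') - (wilsonAction su2Rep (orthoTube L u v') - (L : ℝ) ^ 3 * wilsonAction su2Rep u))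

variable {L}

/-- ★★ **Exact factorisation through the diagonal**: `K(oT u v, g·oT u' v')/K₁(u,u') = [K(oT u v, g·oT u v')/K₁(u,u)]·exp(offX β u u' v v' g)`. [cite: Luscher1983, §3] -/
theorem transferKernel_orthoTube_offdiag_div (β : ℝ) (u u' : GaugeConfig 3 1 SU2) (v v' : Edge 3 L → Fin 3 → ℝ) (g : Site 3 L → SU2) :
    transferKernel su2Rep β (orthoTube L u v) (gaugeTransform g (orthoTube L u' v')) / transferKernel su2Rep ((L : ℝ) ^ 3 * β) u u' =
      transferKernel su2Rep β (orthoTube L u v) (gaugeTransform g (orthoTube L u v')) / transferKernel su2Rep ((L : ℝ) ^ 3 * β) u u *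
        Real.exp (offX L β u u' v v' g) := by
  unfold transferKernel offX
  rw [wilsonAction_gaugeTransform, wilsonAction_gaugeTransform, ← Real.exp_sub, ← Real.exp_sub, ← Real.exp_add]
  congr 1
  ring

/-! ## §2 The kinetic slow-difference of a link is affine in the relative rotation -/

/-- ★ `Re tr(A·h·w·B) − Re tr(A·h·B) = 2[(w⁰ − 1)·(BAh)⁰ − w⃗·(BAh)⃗]`. [cite: BrockerTomDieck1985, I (1.10)] -/
theorem re_trace_mul_mul_mul_sub (A h w B : SU2) :
    ((su2Rep (A * h * w * B)).trace).re - ((su2Rep (A * h * B)).trace).re =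
      2 * ((scalarPart w - 1) * scalarPart (B * A * h) - vecPart w ⬝ᵥ vecPart (B * A * h)) := by
  have h1 : A * h * w * B = (A * h) * w * B := by group
  have h2 : A * h * B = (A * h) * 1 * B := by group
  rw [h1, h2, re_trace_mul_mul_eq, re_trace_mul_mul_eq, PolyakovLift.scalarPart_one, PolyakovLift.vecPart_one, zero_dotProduct,
    show B * (A * h) = B * A * h by group]
  ring

omit [NeZero L] in
/-- On the tube: the link term of `TC(oT u v, g·oT u' v')` is `Re tr(chart(v_e)·Ad_{u_k}(g_y)·w_k·(chart(v'_e)⁻¹g_x⁻¹))`, `w_k = u_ku'_k⁻¹`. [folklore] -/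
theorem orthoTube_mul_gaugeTransform_orthoTube_inv' (u u' : GaugeConfig 3 1 SU2) (g : Site 3 L → SU2) (v v' : Edge 3 L → Fin 3 → ℝ) (e : Edge 3 L) :
    orthoTube L u v e * (gaugeTransform g (orthoTube L u' v') e)⁻¹ =
      chartSU2 (v e) * (u (0, e.2) * g (e.1.shift e.2) * (u (0, e.2))⁻¹) * (u (0, e.2) * (u' (0, e.2))⁻¹) * ((chartSU2 (v' e))⁻¹ * (g e.1)⁻¹) := by
  simp only [orthoTube_apply, gaugeTransform, mul_inv_rev, inv_inv]
  group

/-- ★ **The off-diagonal kinetic slow dependence on the tube**, EXACTLY: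
`TC(oT u v, g·oT u' v') − TC(oT u v, g·oT u v') = Σ_e 2[(w⁰_k − 1)Q⁰_e − a⃗_k·Q⃗_e]`, `Q_e = (chart(v'_e)⁻¹g_x⁻¹)·chart(v_e)·(u_kg_yu_k⁻¹)`, `w_k = u_ku'_k⁻¹`. [cite: Luscher1983, §3] -/
theorem timeCoupling_orthoTube_gauge_offdiag_sub (u u' : GaugeConfig 3 1 SU2) (g : Site 3 L → SU2) (v v' : Edge 3 L → Fin 3 → ℝ) :
    timeCoupling su2Rep (orthoTube L u v) (gaugeTransform g (orthoTube L u' v')) - timeCoupling su2Rep (orthoTube L u v) (gaugeTransform g (orthoTube L u v')) =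
      ∑ e : Edge 3 L, 2 * ((scalarPart (u (0, e.2) * (u' (0, e.2))⁻¹) - 1) *
          scalarPart ((chartSU2 (v' e))⁻¹ * (g e.1)⁻¹ * chartSU2 (v e) * (u (0, e.2) * g (e.1.shift e.2) * (u (0, e.2))⁻¹)) -
        vecPart (u (0, e.2) * (u' (0, e.2))⁻¹) ⬝ᵥ vecPart ((chartSU2 (v' e))⁻¹ * (g e.1)⁻¹ * chartSU2 (v e) * (u (0, e.2) * g (e.1.shift e.2) * (u (0, e.2))⁻¹))) := by
  unfold timeCoupling
  rw [← Finset.sum_sub_distrib]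
  refine Finset.sum_congr rfl fun e _ => ?_
  rw [orthoTube_mul_gaugeTransform_orthoTube_inv', orthoTube_mul_gaugeTransform_orthoTube_inv, re_trace_mul_mul_mul_sub]

/-! ## §3 ★★★ Monotone integration: a pointwise bound on `offX` controls the near-pair ratio -/

/-- ★★★ **(L2), integrated**: for `Ω, W ≥ 0` bounded measurable, if `|offX β u u' v v' g| ≤ η` whenever `Ω(v), Ω(v'), W(g) ≠ 0`, then
`e^{−η}·f(u,u) ≤ f(u,u') ≤ e^{η}·f(u,u)` with `f(u,u') = fpBOKernel β Ω W u u' / K₁^{(L³β)}(u,u')`. [cite: Luscher1983, §3] -/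
theorem fpBOKernel_offdiag_two_sided (β : ℝ) {Ω : LinkSpace L → ℝ} (hΩm : Measurable Ω) {CΩ : ℝ} (hCΩ : ∀ x, |Ω x| ≤ CΩ) (hΩ0 : ∀ x, 0 ≤ Ω x)
    {W : (Site 3 L → SU2) → ℝ} (hW : Measurable W) {CW : ℝ} (hCW : ∀ g, |W g| ≤ CW) (hW0 : ∀ g, 0 ≤ W g) (u u' : GaugeConfig 3 1 SU2) {η : ℝ}
    (hη : ∀ (v v' : Edge 3 L → Fin 3 → ℝ) (g : Site 3 L → SU2), Ω (linkEmbed L v) ≠ 0 → Ω (linkEmbed L v') ≠ 0 → W g ≠ 0 → |offX L β u u' v v' g| ≤ η) :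
    Real.exp (-η) * (fpBOKernel L β Ω W u u / transferKernel su2Rep ((L : ℝ) ^ 3 * β) u u) ≤ fpBOKernel L β Ω W u u' / transferKernel su2Rep ((L : ℝ) ^ 3 * β) u u' ∧
      fpBOKernel L β Ω W u u' / transferKernel su2Rep ((L : ℝ) ^ 3 * β) u u' ≤ Real.exp η * (fpBOKernel L β Ω W u u / transferKernel su2Rep ((L : ℝ) ^ 3 * β) u u) := by
  haveI := isFiniteMeasure_orthoTransverse L
  set μP : Measure ((Edge 3 L → Fin 3 → ℝ) × ((Edge 3 L → Fin 3 → ℝ) × (Site 3 L → SU2))) := (orthoTransverse L).prod ((orthoTransverse L).prod (gaugeMeasure L)) with hμP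
  haveI : IsFiniteMeasure μP := by rw [hμP]; infer_instance
  have hKd : 0 < transferKernel su2Rep ((L : ℝ) ^ 3 * β) u u := transferKernel_pos _ _ _ _
  have hKo : 0 < transferKernel su2Rep ((L : ℝ) ^ 3 * β) u u' := transferKernel_pos _ _ _ _
  -- both as integrals over `μP`
  set ρd : ((Edge 3 L → Fin 3 → ℝ) × ((Edge 3 L → Fin 3 → ℝ) × (Site 3 L → SU2))) → ℝ := fun p => fpTriple L β Ω W u u p / transferKernel su2Rep ((L : ℝ) ^ 3 * β) u u with hρd
  set ρo : ((Edge 3 L → Fin 3 → ℝ) × ((Edge 3 L → Fin 3 → ℝ) × (Site 3 L → SU2))) → ℝ := fun p => fpTriple L β Ω W u u' p / transferKernel su2Rep ((L : ℝ) ^ 3 * β) u u' with hρo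
  obtain ⟨Bd, hBd⟩ := abs_fpTriple_le (L := L) β hCΩ hCW u u
  obtain ⟨Bo, hBo⟩ := abs_fpTriple_le (L := L) β hCΩ hCW u u'
  have hρd_int : Integrable ρd μP := integrable_of_measurable_abs_le _ ((measurable_fpTriple β hΩm hW u u).div_const _) (C := Bd / transferKernel su2Rep ((L : ℝ) ^ 3 * β) u u)
    fun p => by rw [hρd]; dsimp only; rw [abs_div, abs_of_pos hKd]; exact div_le_div_of_nonneg_right (hBd p) hKd.le
  have hρo_int : Integrable ρo μP := integrable_of_measurable_abs_le _ ((measurable_fpTriple β hΩm hW u u').div_const _) (C := Bo / transferKernel su2Rep ((L : ℝ) ^ 3 * β) u u')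
    fun p => by rw [hρo]; dsimp only; rw [abs_div, abs_of_pos hKo]; exact div_le_div_of_nonneg_right (hBo p) hKo.le
  have hfd : fpBOKernel L β Ω W u u / transferKernel su2Rep ((L : ℝ) ^ 3 * β) u u = ∫ p, ρd p ∂μP := by
    rw [hρd, integral_div, hμP, ← fpBOKernel_eq_integral_prod β hΩm hCΩ hW hCW]
  have hfo : fpBOKernel L β Ω W u u' / transferKernel su2Rep ((L : ℝ) ^ 3 * β) u u' = ∫ p, ρo p ∂μP := by
    rw [hρo, integral_div, hμP, ← fpBOKernel_eq_integral_prod β hΩm hCΩ hW hCW]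
  -- pointwise: `ρo = ρd · exp(offX)` and the two-sided bound
  have hpt : ∀ p, ρo p = ρd p * Real.exp (offX L β u u' p.1 p.2.1 p.2.2) := fun p => by
    rw [hρo, hρd]; dsimp only; unfold fpTriple
    have h := transferKernel_orthoTube_offdiag_div (L := L) β u u' p.1 p.2.1 p.2.2
    calc Ω (linkEmbed L p.1) * (W p.2.2 * transferKernel su2Rep β (orthoTube L u p.1) (gaugeTransform p.2.2 (orthoTube L u' p.2.1)) * Ω (linkEmbed L p.2.1)) /
          transferKernel su2Rep ((L : ℝ) ^ 3 * β) u u'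
        = Ω (linkEmbed L p.1) * (W p.2.2 * Ω (linkEmbed L p.2.1)) *
            (transferKernel su2Rep β (orthoTube L u p.1) (gaugeTransform p.2.2 (orthoTube L u' p.2.1)) / transferKernel su2Rep ((L : ℝ) ^ 3 * β) u u') := by ring
      _ = Ω (linkEmbed L p.1) * (W p.2.2 * Ω (linkEmbed L p.2.1)) *
            (transferKernel su2Rep β (orthoTube L u p.1) (gaugeTransform p.2.2 (orthoTube L u p.2.1)) / transferKernel su2Rep ((L : ℝ) ^ 3 * β) u u *
              Real.exp (offX L β u u' p.1 p.2.1 p.2.2)) := by rw [h]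
      _ = _ := by ring
  have hρd0 : ∀ p, 0 ≤ ρd p := fun p => by
    rw [hρd]; dsimp only; unfold fpTriple
    exact div_nonneg (mul_nonneg (hΩ0 _) (mul_nonneg (mul_nonneg (hW0 _) (transferKernel_pos _ _ _ _).le) (hΩ0 _))) hKd.le
  have hbounds : ∀ p, Real.exp (-η) * ρd p ≤ ρo p ∧ ρo p ≤ Real.exp η * ρd p := fun p => by
    rw [hpt p]
    by_cases h0 : ρd p = 0
    · rw [h0]; simp
    · have hne : fpTriple L β Ω W u u p ≠ 0 := by intro hz; apply h0; rw [hρd]; dsimp only; rw [hz, zero_div]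
      have hΩv : Ω (linkEmbed L p.1) ≠ 0 := by intro hz; apply hne; unfold fpTriple; rw [hz, zero_mul]
      have hΩv' : Ω (linkEmbed L p.2.1) ≠ 0 := by intro hz; apply hne; unfold fpTriple; rw [hz, mul_zero, mul_zero]
      have hWg : W p.2.2 ≠ 0 := by intro hz; apply hne; unfold fpTriple; rw [hz, zero_mul, zero_mul, mul_zero]
      have hX := abs_le.mp (hη p.1 p.2.1 p.2.2 hΩv hΩv' hWg)
      have hp0 := hρd0 p
      constructor
      · rw [mul_comm]; exact mul_le_mul_of_nonneg_left (Real.exp_le_exp.mpr hX.1) hp0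
      · rw [mul_comm (Real.exp η)]; exact mul_le_mul_of_nonneg_left (Real.exp_le_exp.mpr hX.2) hp0
  rw [hfd, hfo, ← integral_const_mul, ← integral_const_mul]
  exact ⟨integral_mono (hρd_int.const_mul _) hρo_int fun p => (hbounds p).1, integral_mono hρo_int (hρd_int.const_mul _) fun p => (hbounds p).2⟩

end Summit.QuantumFields.YangMills.Theorems.FemtoTransferGap.TwoLattice.ConstTube

end
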